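import Literature.MathematicalPhysics.QuantumFieldTheory.Balaban1983to89.B6Prop23KLevelCensus

/-!
# `Balaban1983to89.B6Ineq288MultiLevelBox` — [B6] THE FIRST INEQUALITY OF (2.88) FOR THE GENUINE `k`-LEVEL KERNEL
`(∂P∂*)_{μν}(x, x′)`, `P = G′Q′*(Q′G′²Q′*)⁻¹Q′G′` OF (2.17), ON THE NESTED NEUMANN-BOX FAMILY IN PRINT'S UNITS — the census
edge `B6Ineq288Edge.ineq288_of_printed` («from Lemma 2.1, Proposition 2.2 and (2.87)») FIRED WITH EVERY HYPOTHESIS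
DISCHARGED on the genuine multi-level objects (file 7 of the multi-level `(Q′G′²Q′*)⁻¹` programme; no existing module is
touched; no fact is minted)

FRAMING (verbatim cell line):
statement-level skeleton of published theorems with citation tags; proofs where landed; nothing here is a claim about the Yang–Mills mass gap

Source under audit (cell pub-balaban / lit-balaban): T. Bałaban, *Propagators and renormalization transformations for
lattice gauge theories. II*, Commun. Math. Phys. **96** (1984) 223–250 [`Balaban1984PropagatorsII`, "B6"], p. 225 [PDF 3]
((2.17)), p. 238 [PDF 16] ((2.88)) — materialised text `paper:balaban1984-cmp96-propagators-rt-ii` p0003, p0016 re-read this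
generation.  Unit `lit-balaban-p21` (Phase-2 proof seat p21 gen 13), HOME `run/shared/lean/pub/lit-balaban/`, B6 fold owner
r03, referee ref-4.  One-scale template: p01's `B6Ineq288OneScaleTorus` (the same sentence on the one-scale torus family).

## WHAT IS PRINTED (p. 238, verbatim up to notation)

«Finally let us consider the kernel of the operator ∂P∂* appearing in ∂R∂*, R = I − P given by (2.18). We have from
Lemma 2.1, Proposition 2.2 and (2.87), |(∂P∂*)_{μν}(x, x′)| = |(∂_μG′Q′*(Q′G′²Q′*)⁻¹Q′G′∂*_ν)(x, x′)| ≤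
O(1) Σ_{y₁,y₂∈𝔅} L^jη e^{−½δ₀d(y,y₁)}(L^{j₁}η)^{−4}e^{−½δ₁d(y₁,y₂)}(L^{j₂}η)^{−d}·e^{−½δ₀d(y₂,y′)}L^{j′}η ≤
O(1)(L^jη)^{−2}(L^{j′}η)^{−d}e^{−δ₂d(y,y′)}, (2.88) where x ∈ B^j(y), x′ ∈ B^{j′}(y′), y ∈ Λ_j, y′ ∈ Λ_{j′}, and δ₂ is
determined by δ₀, δ₁.»

## WHAT THIS FILE CERTIFIES (kernel-checked)

For every member `i : KIdx d ℓ` of gen 12's genuine `k`-level family (nested Neumann-box domains, printed weights, `G′ = gml`):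
* §1 the census geometry `geoB i` = `geoP i` (print's units `η = L^{−k}`) with the (2.60)-certified `R` (`R·M = R·L·M_h − 1`,
  as in `B6Ineq268MultiLevelBox.geomB`), the census facts `B6.Prop22Printed` (gen 12 `prop22Printed_kLevelP`) and
  `B6.Prop23Printed` (`prop23Printed_kLevelP`) TRANSFERRED to it (they do not involve `R`), (2.54), symmetry, (2.60) as
  `Ineq260` (`ineq260_geoB`, from `levelSepB`) and (2.61) (`lemma21_box`);
* §2 the operator `P = G′Q′*(Q′G′²Q′*)⁻¹Q′G′` of (2.17) as a matrix on the fine box (`pM`; `Q′* = QsM`, `Q′ = QM`,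
  `(Q′G′²Q′*)⁻¹ = GiM` = the inverse `B6Prop23KLevelCensus.Ginv`; `toMatrix_Xop`, `GiM_mul`: it IS the two-sided inverse of
  the matrix `Q′G′²Q′*`; **`pM_mul_pM`**, **`pM_transpose`**: `P² = P = Pᵀ`; `rM = I − P`, **`rM_mulVec_eq`** (`Rf = Δ′_aλ` with
  the printed `λ`, `Q′λ = 0`: `QM_mulVec_lamOf`) and **`rM_mulVec_dP_of_ker`** (`R(Δ′_aλ) = Δ′_aλ` for `λ ∈ N(Q′)`): `R` IS
  the orthogonal projection onto `Δ′_aN(Q′)` of p. 225, i.e. this `P` is the paper's), the kernel `(∂_μP∂_νᵀ)(x, x′)`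
  (`dPd`), and the EXACT
  factorisation **`dPd_eq_comp3`**: `(∂_μP∂*_ν)(x, x′) = Σ_{y₁,y₂} K₁(y, y₁)·C(y₁, y₂)·K₃(y₂, y′)` with
  `K₁(y, y₁) = (∂_μG′Q′*δ_{y₁})(x)`, `K₃(y₂, y′) = (∂_νG′Q′*δ_{y₂})(x′)` (`K1`, `K3`; `G′` symmetric) and `C` = the
  (2.69)-kernel of `(Q′G′²Q′*)⁻¹` (`Cker`); in print's units (`∂^η = η⁻¹∂`, kernels `η^{−(d+1)}`·entries) the same identity
  with `η·K` and `B6Prop23KLevelCensus.CinvP` (`dPdP_eq_comp3`);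
* §3 THE READING DISCHARGED: `λ_{y₁} = Q′*δ_{y₁} = 1_{B(y₁)}` (`lam`) has `supp ⊂ B(y₁)`, `|λ| ≤ 1`, and
  `|η·K₁(y, y₁)| ≤ (gpP i).e 1 (λ_{y₁}) y` — the outer kernels ARE dominated by entry (2.67)₂ `∇G′` of the genuine functionals
  (`abs_K1P_le`);
* §4 **`ineq288_kLevelP`** — THE PRINTED (2.88) FOR THE GENUINE `k`-LEVEL KERNEL: `∃ M₃ δ₂ C > 0 ∀ i, M₃ ≤ L·M_h →
  ∀ μ ν x x′, |(∂P∂*)_{μν}(x, x′)| ≤ C·(L^jη)^{−2}(L^{j′}η)^{−(d+1)}e^{−δ₂d(y,y′)}`, `x ∈ B^j(y)`, `x′ ∈ B^{j′}(y′)`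
  (`B6Ineq288Edge.ineq288_of_printed` BY NAME on `geoB` with §1–§3 and the three largeness conditions `L⁴, L^{d+1}, L ≤
  e^{αδRM}` exhibited, `α = ½`, `δ = min(δ₀, δ₁)/4`); `ineq288_read_kLevelP` — the census decl `B6Cor28.Ineq288` inhabited
  for the genuine kernels.

## HONEST SCOPE

`P` is DEFINED by (2.17) (`pM`) and PROVED to be the paper's: `I − P` is symmetric, idempotent, maps into `Δ′_aN(Q′)` and
fixes it (§2); levels `1 … k` on a Neumann box, `m² = 0`, `R ≥ 2L`, `L ≥ 2`;
the census geometry carries the (2.60)-certified `R − 1/(L·M_h)` for print's integer `R` (the walk constant `RM − 1` of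
`B6Geom246MultiLevelBox.levelGap`); `∂_μ` = the forward difference of the Neumann box (`dMat`, zero across `∂X`),
`∂*_ν = ∂_νᵀ` (equal site weights); constants existential, depending on `d`, `L`; thresholds folded into `L·M_h ≥ M₃`.
Nothing is inferred from the manuscript: every step is kernel-checked.
-/

namespace Literature.MathematicalPhysics.QuantumFieldTheory.Balaban1983to89.B6Ineq288MultiLevelBox

open Finset Matrix
open Literature.MathematicalPhysics.QuantumFieldTheory.Balaban1983to89.B4Reflection242 (boxDom)
open Literature.MathematicalPhysics.QuantumFieldTheory.Balaban1983to89.B6MultiLevelBoxOperator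
open Literature.MathematicalPhysics.QuantumFieldTheory.Balaban1983to89.B6Geom246MultiLevelBox
open Literature.MathematicalPhysics.QuantumFieldTheory.Balaban1983to89.B6Ineq268MultiLevelBox
open Literature.MathematicalPhysics.QuantumFieldTheory.Balaban1983to89.B6Prop23KLevelCensus
open Literature.MathematicalPhysics.QuantumFieldTheory.Balaban1983to89.B6Prop22DerivMultiLevelBox (dMat)
open Literature.MathematicalPhysics.QuantumFieldTheory.Balaban1983to89.B6Prop23Chain (mat)
open Literature.MathematicalPhysics.QuantumFieldTheory.Balaban1983to89.B6Prop22KLevelCensus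
open Literature.MathematicalPhysics.QuantumFieldTheory.Balaban1983to89.B6Prop22KLevelCensusEta (nK nK_pos geoP gpP geoP_len
  kLevelP_nonvacuous)
open Literature.MathematicalPhysics.QuantumFieldTheory.Balaban1983to89.B6Prop22KLevelCensusEtaUnif (prop22Printed_kLevelP)
open Literature.MathematicalPhysics.QuantumFieldTheory.Balaban1983to89.B6Ineq288Edge (ineq288_of_printed)
open Literature.MathematicalPhysics.QuantumFieldTheory.Balaban1983to89.B6RandomWalk (Triangle254 Ineq260)
open Literature.MathematicalPhysics.QuantumFieldTheory.Balaban1983to89.B6Lemma21Repaired (Ineq261With)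
open Literature.MathematicalPhysics.QuantumFieldTheory.Balaban1983to89.B6Cor28 (Ineq288 comp3)
open Literature.MathematicalPhysics.QuantumFieldTheory.Balaban1983to89.B6Ineq268 (LevelSep mx)
open Literature.MathematicalPhysics.QuantumFieldTheory.Balaban1983to89.B6Geometry (dist_comm_of_realizes)
open Literature.MathematicalPhysics.QuantumFieldTheory.Balaban1983to89.B6Ineq261LevelGap (K261 K261_nonneg
  theta_lt_one_of_log)
open Literature.MathematicalPhysics.QuantumFieldTheory.Balaban1983to89.B6 (Geometry GpFamily SiteKernel Prop22Printed
  Prop23Printed pref4)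

noncomputable section

variable {d : ℕ}

/-! ## §1 The census geometry with the (2.60)-certified `R`; the census facts transferred; Lemma 2.1 -/

section GeoB

variable {ℓ : ℕ} (i : KIdx d ℓ)

/-- the census geometry of the member in print's units with the (2.60)-certified `R` (`R·M = R·L·M_h − 1`, the walk
constant of `levelGap`); all other fields are those of gen 12's `geoP`. [cite: Balaban1984PropagatorsII, (2.1)–(2.2) p.224, (2.60) p.234, dictionary] -/
def geoB : Geometry :=
  { geoP i with R := (i.R : ℝ) - 1 / (((ℓ : ℝ) + 1) * i.Mh) }

/-- the (2.67) functionals of the member, re-packed on `geoB`. [cite: Balaban1984PropagatorsII, Prop. 2.2 (2.67) p.234, dictionary] -/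
def gpB : GpFamily (geoB i) := ⟨(gpP i).e, (gpP i).h1⟩

/-- the (2.69)-kernel of `(Q′G′²Q′*)⁻¹` of the member in print's units, re-packed on `geoB`. [cite: Balaban1984PropagatorsII, (2.87) p.238, dictionary] -/
def CinvB : SiteKernel (geoB i) := ⟨(CinvP i).ker⟩

/-- `R·M` of `geoB` is the certified walk constant `R·L·M_h − 1`. [cite: Balaban1984PropagatorsII, (2.2) p.224, (2.60) p.234, dictionary] -/
theorem geoB_RM : (geoB i).R * (geoB i).M = (i.R : ℝ) * (((ℓ : ℝ) + 1) * i.Mh) - 1 := by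
  have hM : (0 : ℝ) < ((ℓ : ℝ) + 1) * i.Mh := by
    have := i.hMh; have : (1 : ℝ) ≤ i.Mh := by exact_mod_cast i.hMh
    positivity
  show ((i.R : ℝ) - 1 / (((ℓ : ℝ) + 1) * i.Mh)) * (((ℓ : ℝ) + 1) * i.Mh) = _
  rw [sub_mul, one_div, inv_mul_cancel₀ hM.ne']

/-- `geoB` in components. [cite: Balaban1984PropagatorsII, (2.1) p.224, dictionary] -/
theorem geoB_M : (geoB i).M = ((ℓ : ℝ) + 1) * i.Mh := rfl
/-- … `L`. [cite: Balaban1984PropagatorsII, (2.1) p.224, dictionary] -/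
theorem geoB_L : (geoB i).L = (ℓ : ℝ) + 1 := rfl
/-- … `η = L^{−k}`. [cite: Balaban1984PropagatorsII, (2.1) p.224, dictionary] -/
theorem geoB_eta : (geoB i).eta = (((nK i : ℕ) : ℝ))⁻¹ := rfl
/-- … the lengths `L^jη`. [cite: Balaban1984PropagatorsII, (2.1) p.224, dictionary] -/
theorem geoB_len (s : ↥(bset i.D)) : (geoB i).len s = ((ℓ : ℝ) + 1) ^ s.1.1 * (((nK i : ℕ) : ℝ))⁻¹ := rfl
/-- … the distance (2.46). [cite: Balaban1984PropagatorsII, (2.46) p.231, dictionary] -/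
theorem geoB_dist (s t : ↥(bset i.D)) : (geoB i).dist s t = (geom i.D).dist s t := rfl

/-- **PROPOSITION 2.2 ON `geoB`** (gen 12's `prop22Printed_kLevelP`; the census statement does not involve `R`).
[cite: Balaban1984PropagatorsII, Prop. 2.2 (2.67) p.234] -/
theorem prop22Printed_kLevelB (hℓ : 1 ≤ ℓ) : Prop22Printed (fun i : KIdx d ℓ => geoB i) (fun i => gpB i) :=
  prop22Printed_kLevelP d ℓ hℓ

/-- **PROPOSITION 2.3 ON `geoB`** (`prop23Printed_kLevelP`). [cite: Balaban1984PropagatorsII, Prop. 2.3 (2.86)–(2.87) p.238] -/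
theorem prop23Printed_kLevelB (hℓ : 1 ≤ ℓ) : Prop23Printed (d + 1) (fun i : KIdx d ℓ => geoB i) (fun i => CinvB i) :=
  prop23Printed_kLevelP d ℓ hℓ

/-- (2.54) for `geoB` (realised geometry). [cite: Balaban1984PropagatorsII, (2.54) p.232] -/
theorem triangle_geoB : Triangle254 (geoB i) := (triangle_refl_nonneg i.D i.hMh i.hP).1

/-- `d ≥ 0` for `geoB`. [cite: Balaban1984PropagatorsII, (2.46) p.231] -/
theorem dist_nonneg_geoB (y y' : (geoB i).Site) : 0 ≤ (geoB i).dist y y' := (triangle_refl_nonneg i.D i.hMh i.hP).2.2 y y'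

/-- `d` is symmetric for `geoB`. [cite: Balaban1984PropagatorsII, (2.46) p.231] -/
theorem dist_symm_geoB (a b : (geoB i).Site) : (geoB i).dist a b = (geoB i).dist b a :=
  dist_comm_of_realizes (realizes i.D) a b

/-- **(2.60) FOR `geoB`** as the census display `Ineq260` (from `levelSepB`: `RM·max{|j−j′|−1,0} ≤ d`).
[cite: Balaban1984PropagatorsII, Lemma 2.1 (2.60) p.234] -/
theorem ineq260_geoB {δ α : ℝ} (hαδ : 0 ≤ α * δ) : Ineq260 (geoB i) δ α := by
  intro y y'
  have hRM1 : 1 ≤ i.R * ((ℓ + 1) * i.Mh) :=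
    Nat.one_le_iff_ne_zero.2 (Nat.mul_ne_zero_iff.2 ⟨by have := i.hR; omega,
      Nat.mul_ne_zero_iff.2 ⟨by omega, by have := i.hMh; omega⟩⟩)
  have hsep : LevelSep (geoB i) := levelSepB i.D i.hMh i.hP hRM1
  have h := hsep y y'
  apply Real.exp_le_exp.2
  have : α * δ * ((geoB i).R * (geoB i).M * mx (geoB i) y y') ≤ α * δ * (geoB i).dist y y' :=
    mul_le_mul_of_nonneg_left h hαδ
  unfold mx at this
  linarith

end GeoB

/-! ## §2 The operator `P` of (2.17) on the fine box and the factorisation of `(∂P∂*)(x, x′)` -/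

section Kernel

variable {ℓ : ℕ} (i : KIdx d ℓ)

/-- `Q′*` (block-constant extension) as a matrix `X × 𝔅`. [cite: Balaban1984PropagatorsII, (2.16)–(2.17) p.225, dictionary] -/
def QsM : Matrix ↥(i.XB) ↥(bset i.D) ℝ := fun x y₁ => if blkOf i.D x = y₁ then 1 else 0

/-- `Q′` (block average) as a matrix `𝔅 × X`. [cite: Balaban1984PropagatorsII, (2.16)–(2.17) p.225, dictionary] -/
def QM : Matrix ↥(bset i.D) ↥(i.XB) ℝ := fun y₂ x => if blkOf i.D x = y₂ then (W i.D y₂)⁻¹ else 0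

/-- `(Q′G′²Q′*)⁻¹` as a matrix on `𝔅` (the inverse operator `Ginv` of `B6Prop23KLevelCensus`). [cite: Balaban1984PropagatorsII, (2.17) p.225, (2.86) p.238] -/
def GiM : Matrix ↥(bset i.D) ↥(bset i.D) ℝ := fun y₁ y₂ => mat (Ginv i) y₁ y₂

/-- **`P = G′Q′*(Q′G′²Q′*)⁻¹Q′G′`** of (2.17) as a matrix on the fine box. [cite: Balaban1984PropagatorsII, (2.17) p.225] -/
def pM : Matrix ↥(i.XB) ↥(i.XB) ℝ := i.G * QsM i * GiM i * QM i * i.G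

/-- `(∂_μP∂*_ν)(x, x′)` — the matrix `∂_μ·P·∂_νᵀ` (forward differences of the Neumann box, `∂* = ∂ᵀ`).
[cite: Balaban1984PropagatorsII, (2.88) p.238] -/
def dPd (μ ν : Fin (d + 1)) : Matrix ↥(i.XB) ↥(i.XB) ℝ := dMat i.NB μ * pM i * (dMat i.NB ν)ᵀ

/-- `λ_{y₁} = Q′*δ_{y₁} = 1_{B(y₁)}` («λ = Q′*δ_{y₁}», the reader's test function). [cite: Balaban1984PropagatorsII, (2.88) p.238 («∂_μG′Q′*»)] -/
def lam (y₁ : ↥(bset i.D)) : ↥(i.XB) → ℝ := fun x => if blkOf i.D x = y₁ then 1 else 0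

/-- the left outer kernel `K₁(y, y₁) = (∂_μG′Q′*δ_{y₁})(x)` for `x ∈ B(y)` (zero on other rows). [cite: Balaban1984PropagatorsII, (2.88) p.238] -/
def K1 (μ : Fin (d + 1)) (x : ↥(i.XB)) : ↥(bset i.D) → ↥(bset i.D) → ℝ :=
  fun y y₁ => if blkOf i.D x = y then ((dMat i.NB μ * i.G) *ᵥ lam i y₁) x else 0

/-- the right outer kernel `K₃(y₂, y′) = (∂_νG′Q′*δ_{y₂})(x′)` for `x′ ∈ B(y′)`. [cite: Balaban1984PropagatorsII, (2.88) p.238] -/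
def K3 (ν : Fin (d + 1)) (x' : ↥(i.XB)) : ↥(bset i.D) → ↥(bset i.D) → ℝ :=
  fun y₂ y' => if blkOf i.D x' = y' then ((dMat i.NB ν * i.G) *ᵥ lam i y₂) x' else 0

/-- the (2.69)-kernel of `(Q′G′²Q′*)⁻¹` in lattice units: `Ginv(y₁, y₂)/(L^{j₂})^{d+1}`. [cite: Balaban1984PropagatorsII, (2.69) p.235, (2.87) p.238] -/
def Cker : ↥(bset i.D) → ↥(bset i.D) → ℝ := fun y₁ y₂ => mat (Ginv i) y₁ y₂ / W i.D y₂

/-- `Q′*` is the matrix of `QsB`. [cite: Balaban1984PropagatorsII, (2.16) p.225, bookkeeping] -/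
theorem toMatrix_QsB : LinearMap.toMatrix' (QsB i.D) = QsM i := by
  ext x y₁
  rw [LinearMap.toMatrix'_apply, QsB_apply]
  unfold QsM
  rw [Pi.single_apply]

/-- `Q′` is the matrix of `QB`. [cite: Balaban1984PropagatorsII, (2.14) p.225, bookkeeping] -/
theorem toMatrix_QB : LinearMap.toMatrix' (QB i.D) = QM i := by
  ext y₂ x
  rw [LinearMap.toMatrix'_apply]
  unfold QB
  rw [B6Ineq2142.avgOp_apply]
  rw [Finset.sum_eq_single x (fun x' _ hx' => by rw [Pi.single_apply, if_neg hx', mul_zero])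
    (fun h => absurd (Finset.mem_univ x) h)]
  rw [Pi.single_apply, if_pos rfl, mul_one]
  rfl

/-- `Q′G′²Q′*` is the matrix of the operator `Xop` of `B6Prop23KLevelCensus`. [cite: Balaban1984PropagatorsII, (2.17) p.225, bookkeeping] -/
theorem toMatrix_Xop : LinearMap.toMatrix' (Xop i) = QM i * i.G * i.G * QsM i := by
  unfold Xop
  rw [kerOp_Xk, LinearMap.toMatrix'_comp, LinearMap.toMatrix'_comp, LinearMap.toMatrix'_comp,
    LinearMap.toMatrix'_toLin', toMatrix_QB, toMatrix_QsB]
  simp only [Matrix.mul_assoc]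
  rfl

/-- `GiM` is the matrix of `Ginv`. [cite: Balaban1984PropagatorsII, (2.17) p.225, bookkeeping] -/
theorem toMatrix_Ginv : LinearMap.toMatrix' (Ginv i) = GiM i := by
  ext y₁ y₂
  rw [LinearMap.toMatrix'_apply]
  rfl

/-- `(Q′G′²Q′*)⁻¹·(Q′G′²Q′*) = 1` and `(Q′G′²Q′*)·(Q′G′²Q′*)⁻¹ = 1` as matrices. [cite: Balaban1984PropagatorsII, (2.17) p.225, Prop. 2.3 p.238] -/
theorem GiM_mul (hℓ : 1 ≤ ℓ) : GiM i * (QM i * i.G * i.G * QsM i) = 1 ∧ (QM i * i.G * i.G * QsM i) * GiM i = 1 := by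
  have h1 : GiM i * (QM i * i.G * i.G * QsM i) = 1 := by
    rw [← toMatrix_Ginv, ← toMatrix_Xop, ← LinearMap.toMatrix'_mul, Ginv_mul i hℓ]
    exact LinearMap.toMatrix'_id
  exact ⟨h1, mul_eq_one_comm.1 h1⟩

/-- **`P² = P`**: the operator (2.17) is a projection (it is symmetric by `G′ᵀ = G′`, so `R = I − P` is an orthogonal
projection, p. 225). [cite: Balaban1984PropagatorsII, (2.17) p.225 («let R be an orthogonal projection»)] -/
theorem pM_mul_pM (hℓ : 1 ≤ ℓ) : pM i * pM i = pM i := by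
  have hX := (GiM_mul i hℓ).2
  have key : ∀ Z : Matrix ↥(bset i.D) ↥(i.XB) ℝ, QM i * (i.G * (i.G * (QsM i * (GiM i * Z)))) = Z := by
    intro Z
    calc QM i * (i.G * (i.G * (QsM i * (GiM i * Z)))) = (QM i * i.G * i.G * QsM i * GiM i) * Z := by
          simp only [Matrix.mul_assoc]
      _ = Z := by rw [hX, Matrix.one_mul]
  unfold pM
  simp only [Matrix.mul_assoc]
  rw [key]

/-- `R = I − P` of (2.17)–(2.18). [cite: Balaban1984PropagatorsII, (2.17)–(2.18) p.225] -/
def rM : Matrix ↥(i.XB) ↥(i.XB) ℝ := 1 - pM i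

/-- `R² = R`. [cite: Balaban1984PropagatorsII, (2.17) p.225] -/
theorem rM_mul_rM (hℓ : 1 ≤ ℓ) : rM i * rM i = rM i := by
  unfold rM
  rw [sub_mul, one_mul, mul_sub, mul_one, pM_mul_pM i hℓ, sub_self, sub_zero]

/-- `Δ′_a` of the member (printed weights, level-`0` weight immaterial). [cite: Balaban1984PropagatorsII, (2.9) p.225] -/
abbrev dP : Matrix ↥(i.XB) ↥(i.XB) ℝ := mlOp i.NB ℓ i.k i.D.lev (aPrinted ℓ 1)

/-- `Δ′_a·G′ = 1`. [cite: Balaban1984PropagatorsII, p.225 («G′ = Δ′_a^{−1}»)] -/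
theorem dP_mul_G (hℓ : 1 ≤ ℓ) : dP i * i.G = 1 := mlOp_mul_gml_member i hℓ

/-- `G′·Δ′_a = 1`. [cite: Balaban1984PropagatorsII, p.225 («G′ = Δ′_a^{−1}»)] -/
theorem G_mul_dP (hℓ : 1 ≤ ℓ) : i.G * dP i = 1 := mul_eq_one_comm.1 (dP_mul_G i hℓ)

/-- the printed `λ = G′f − G′²Q′*(Q′G′²Q′*)⁻¹Q′G′f` of the line before (2.17). [cite: Balaban1984PropagatorsII, p.225 (line before (2.17))] -/
def lamOf (f : ↥(i.XB) → ℝ) : ↥(i.XB) → ℝ :=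
  i.G *ᵥ f - i.G *ᵥ (i.G *ᵥ (QsM i *ᵥ (GiM i *ᵥ (QM i *ᵥ (i.G *ᵥ f)))))

/-- `Q′λ = 0`: `λ ∈ N(Q′)`. [cite: Balaban1984PropagatorsII, p.225 («onto the subspace ΔN(Q′)»)] -/
theorem QM_mulVec_lamOf (hℓ : 1 ≤ ℓ) (f : ↥(i.XB) → ℝ) : QM i *ᵥ lamOf i f = 0 := by
  unfold lamOf
  rw [Matrix.mulVec_sub]
  simp only [Matrix.mulVec_mulVec, ← Matrix.mul_assoc]
  rw [show QM i * i.G * i.G * QsM i * GiM i = 1 from (GiM_mul i hℓ).2, Matrix.one_mul, sub_self]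

/-- **(2.17) FOR THE GENUINE OPERATORS**: `Rf = Δ′_aλ` with the printed `λ` (and `Q′λ = 0`, `QM_mulVec_lamOf`): `R` maps into
`Δ′_aN(Q′)`. [cite: Balaban1984PropagatorsII, (2.17) p.225 («Rf = Δλ = Δ′_aλ = f − G′Q′*(Q′G′²Q′*)⁻¹Q′G′f»)] -/
theorem rM_mulVec_eq (hℓ : 1 ≤ ℓ) (f : ↥(i.XB) → ℝ) : rM i *ᵥ f = dP i *ᵥ lamOf i f := by
  unfold rM lamOf pM
  rw [Matrix.sub_mulVec, Matrix.one_mulVec, Matrix.mulVec_sub]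
  simp only [Matrix.mulVec_mulVec, ← Matrix.mul_assoc]
  rw [dP_mul_G i hℓ, Matrix.one_mulVec, Matrix.one_mul]

/-- … and `R` FIXES `Δ′_aN(Q′)`: `R(Δ′_aλ) = Δ′_aλ` whenever `Q′λ = 0` — with `R² = R`, `Rᵀ = R` (`rM_transpose`) this says
that `R = I − P` IS the orthogonal projection onto `Δ′_aN(Q′)` of p. 225, i.e. `pM` is the paper's `P`.
[cite: Balaban1984PropagatorsII, p.225 («let R be an orthogonal projection in the space L²(T_η) onto the subspace ΔN(Q′)»)] -/
theorem rM_mulVec_dP_of_ker (hℓ : 1 ≤ ℓ) {lam : ↥(i.XB) → ℝ} (h : QM i *ᵥ lam = 0) :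
    rM i *ᵥ (dP i *ᵥ lam) = dP i *ᵥ lam := by
  unfold rM pM
  rw [Matrix.sub_mulVec, Matrix.one_mulVec, sub_eq_self]
  simp only [Matrix.mulVec_mulVec]
  rw [Matrix.mul_assoc _ i.G (dP i), G_mul_dP i hℓ, Matrix.mul_one, ← Matrix.mulVec_mulVec, h,
    Matrix.mulVec_zero]

/-- the block-volume diagonal `diag(W)` on `𝔅` and `Q′ = diag(W)⁻¹·Q′*ᵀ`, `Q′*ᵀ = diag(W)·Q′`. [cite: Balaban1984PropagatorsII, (2.69) p.235, bookkeeping] -/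
theorem QM_eq_diag_mul : QM i = Matrix.diagonal (fun y => (W i.D y)⁻¹) * (QsM i)ᵀ := by
  ext y x
  rw [Matrix.diagonal_mul, Matrix.transpose_apply]
  unfold QM QsM
  split_ifs <;> simp

/-- `Q′*ᵀ = diag(W)·Q′`. [cite: Balaban1984PropagatorsII, (2.69) p.235, bookkeeping] -/
theorem QsM_transpose : (QsM i)ᵀ = Matrix.diagonal (fun y => W i.D y) * QM i := by
  ext y x
  rw [Matrix.diagonal_mul, Matrix.transpose_apply]
  unfold QM QsM
  split_ifs
  · rw [mul_inv_cancel₀ (W_pos i.D y).ne']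
  · rw [mul_zero]

/-- **`Pᵀ = P`**: the operator (2.17) is symmetric for the flat pairing of the fine box (through `diag(W)·(Q′G′²Q′*)⁻¹`
symmetric, `Q′*ᵀG′²Q′*` symmetric, `G′ᵀ = G′`). [cite: Balaban1984PropagatorsII, (2.17) p.225 («orthogonal projection»)] -/
theorem pM_transpose (hℓ : 1 ≤ ℓ) : (pM i)ᵀ = pM i := by
  have hG : i.Gᵀ = i.G := gml_isSymm (N := i.NB) (ℓ := ℓ) (k := i.k) (lev := i.D.lev) (a := aPrinted ℓ 1)
  obtain ⟨hGX, hXG⟩ := GiM_mul i hℓ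
  -- `Dg = diag(W)`, `Dgi = diag(W⁻¹)`
  obtain ⟨Dg, hDg⟩ : ∃ Dg : Matrix ↥(bset i.D) ↥(bset i.D) ℝ, Dg = Matrix.diagonal (fun y => W i.D y) := ⟨_, rfl⟩
  obtain ⟨Dgi, hDgi⟩ : ∃ Dgi : Matrix ↥(bset i.D) ↥(bset i.D) ℝ, Dgi = Matrix.diagonal (fun y => (W i.D y)⁻¹) :=
    ⟨_, rfl⟩
  have hDD : Dg * Dgi = 1 := by
    rw [hDg, hDgi, Matrix.diagonal_mul_diagonal, ← Matrix.diagonal_one]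
    congr 1; funext y; exact mul_inv_cancel₀ (W_pos i.D y).ne'
  have hDiD : Dgi * Dg = 1 := mul_eq_one_comm.1 hDD
  have hDgT : Dgᵀ = Dg := by rw [hDg, Matrix.diagonal_transpose]
  have L2 : (QsM i)ᵀ = Dg * QM i := by rw [hDg]; exact QsM_transpose i
  have L1 : (QM i)ᵀ = QsM i * Dgi := by
    rw [QM_eq_diag_mul, Matrix.transpose_mul, Matrix.transpose_transpose, Matrix.diagonal_transpose, hDgi]
  -- `S = Q′*ᵀG′²Q′* = Dg·X` is symmetric (`X = Q′G′²Q′*`)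
  have hS : Dg * (QM i * i.G * i.G * QsM i) = (QsM i)ᵀ * i.G * i.G * QsM i := by
    rw [L2]; simp only [Matrix.mul_assoc]
  have hSsymm : ((QsM i)ᵀ * i.G * i.G * QsM i)ᵀ = (QsM i)ᵀ * i.G * i.G * QsM i := by
    rw [Matrix.transpose_mul, Matrix.transpose_mul, Matrix.transpose_mul, Matrix.transpose_transpose, hG]
    simp only [Matrix.mul_assoc]
  -- `T = Dg·GiM` is symmetric: `GiMᵀ·Dg·X = Dg = Dg·GiM·X`, cancel `X` by `X·GiM = 1`
  have hSG : (QsM i)ᵀ * i.G * i.G * QsM i * GiM i = Dg := by rw [← hS, Matrix.mul_assoc, hXG, Matrix.mul_one]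
  have hTt : (GiM i)ᵀ * Dg * (QM i * i.G * i.G * QsM i) = Dg := by
    rw [Matrix.mul_assoc, hS, ← hSsymm, ← Matrix.transpose_mul, hSG, hDgT]
  have hT : (GiM i)ᵀ * Dg = Dg * GiM i := by
    have h1 : (GiM i)ᵀ * Dg * (QM i * i.G * i.G * QsM i) = Dg * GiM i * (QM i * i.G * i.G * QsM i) := by
      rw [hTt, Matrix.mul_assoc, hGX, Matrix.mul_one]
    calc (GiM i)ᵀ * Dg = (GiM i)ᵀ * Dg * (QM i * i.G * i.G * QsM i) * GiM i := by
          rw [Matrix.mul_assoc ((GiM i)ᵀ * Dg), hXG, Matrix.mul_one]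
      _ = Dg * GiM i * (QM i * i.G * i.G * QsM i) * GiM i := by rw [h1]
      _ = Dg * GiM i := by rw [Matrix.mul_assoc (Dg * GiM i), hXG, Matrix.mul_one]
  have hGi : Dgi * (GiM i)ᵀ * Dg = GiM i := by
    rw [Matrix.mul_assoc, hT, ← Matrix.mul_assoc, hDiD, Matrix.one_mul]
  -- assemble
  calc (pM i)ᵀ = i.G * (QsM i * (Dgi * ((GiM i)ᵀ * (Dg * (QM i * i.G))))) := by
        unfold pM
        simp only [Matrix.transpose_mul, hG, L1, L2, Matrix.mul_assoc]
    _ = i.G * (QsM i * ((Dgi * (GiM i)ᵀ * Dg) * (QM i * i.G))) := by simp only [Matrix.mul_assoc]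
    _ = pM i := by rw [hGi]; unfold pM; simp only [Matrix.mul_assoc]

/-- `Rᵀ = R`. [cite: Balaban1984PropagatorsII, (2.17) p.225 («orthogonal projection»)] -/
theorem rM_transpose (hℓ : 1 ≤ ℓ) : (rM i)ᵀ = rM i := by
  unfold rM
  rw [Matrix.transpose_sub, Matrix.transpose_one, pM_transpose i hℓ]

/-- the left factor `∂_μG′Q′*` has the entries `(∂_μG′λ_{y₁})(x)`. [cite: Balaban1984PropagatorsII, (2.88) p.238, bookkeeping] -/
theorem left_entry (μ : Fin (d + 1)) (x : ↥(i.XB)) (y₁ : ↥(bset i.D)) :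
    (dMat i.NB μ * i.G * QsM i) x y₁ = ((dMat i.NB μ * i.G) *ᵥ lam i y₁) x := by
  rw [Matrix.mul_apply]
  rfl

/-- the right factor `Q′G′∂_νᵀ` has the entries `(L^{j₂})^{−(d+1)}·(∂_νG′λ_{y₂})(x′)` (`G′` symmetric).
[cite: Balaban1984PropagatorsII, (2.88) p.238, bookkeeping] -/
theorem right_entry (ν : Fin (d + 1)) (y₂ : ↥(bset i.D)) (x' : ↥(i.XB)) :
    (QM i * i.G * (dMat i.NB ν)ᵀ) y₂ x' = (W i.D y₂)⁻¹ * ((dMat i.NB ν * i.G) *ᵥ lam i y₂) x' := by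
  have hsymm : ∀ a b : ↥(i.XB), i.G a b = i.G b a := fun a b => by
    have h : i.Gᵀ = i.G := gml_isSymm (N := i.NB) (ℓ := ℓ) (k := i.k) (lev := i.D.lev) (a := aPrinted ℓ 1)
    have h' := congrFun (congrFun h b) a
    rw [Matrix.transpose_apply] at h'
    exact h'
  rw [Matrix.mul_apply]
  simp only [Matrix.transpose_apply, Matrix.mul_apply]
  rw [← Matrix.mulVec_mulVec]
  simp only [Matrix.mulVec, dotProduct]
  rw [Finset.mul_sum]
  refine Finset.sum_congr rfl fun x'' _ => ?_
  have hQ : ∀ z, QM i y₂ z * i.G z x'' = (W i.D y₂)⁻¹ * (i.G x'' z * lam i y₂ z) := by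
    intro z
    unfold QM lam
    split_ifs with h
    · rw [hsymm z x'']; ring
    · ring
  simp_rw [hQ]
  rw [← Finset.mul_sum]
  ring

/-- the entries of a triple matrix product as a double sum. [folklore] -/
private theorem triple_apply {X S : Type*} [Fintype X] [Fintype S] (A : Matrix X S ℝ) (B : Matrix S S ℝ)
    (Cm : Matrix S X ℝ) (x x' : X) : (A * B * Cm) x x' = ∑ y₁, ∑ y₂, A x y₁ * B y₁ y₂ * Cm y₂ x' := by
  rw [Matrix.mul_apply]
  simp_rw [Matrix.mul_apply, Finset.sum_mul]
  rw [Finset.sum_comm]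

/-- **THE FACTORISATION OF (2.88), EXACT**: `(∂_μP∂*_ν)(x, x′) = Σ_{y₁,y₂∈𝔅} (∂_μG′Q′*)(x, y₁)·(Q′G′²Q′*)⁻¹(y₁, y₂)·
(Q′G′∂*_ν)(y₂, x′)` with the middle factor in the (2.69) normalisation, `x ∈ B(y)`, `x′ ∈ B(y′)`.
[cite: Balaban1984PropagatorsII, (2.88) p.238 («|(∂_μG′Q′*(Q′G′²Q′*)⁻¹Q′G′∂*_ν)(x, x′)|»)] -/
theorem dPd_eq_comp3 (μ ν : Fin (d + 1)) (x x' : ↥(i.XB)) :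
    dPd i μ ν x x' = comp3 (K1 i μ x) (Cker i) (K3 i ν x') (blkOf i.D x) (blkOf i.D x') := by
  have hassoc : dPd i μ ν = (dMat i.NB μ * i.G * QsM i) * GiM i * (QM i * i.G * (dMat i.NB ν)ᵀ) := by
    unfold dPd pM; simp only [Matrix.mul_assoc]
  rw [hassoc, triple_apply]
  unfold comp3
  refine Finset.sum_congr rfl fun y₁ _ => Finset.sum_congr rfl fun y₂ _ => ?_
  rw [left_entry, right_entry]
  unfold K1 K3 Cker GiM
  rw [if_pos rfl, if_pos rfl]
  ring

/-- the printed kernel in print's units: `(∂P∂*)_{μν}(x, x′) = η^{−2−(d+1)}·(∂_μP∂_νᵀ)(x, x′)` (`∂^η = η⁻¹∂`, `P` scale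
free, kernels of the `η`-lattice are `η^{−(d+1)}`× matrix entries, (2.150) p.249). [cite: Balaban1984PropagatorsII, (2.88) p.238, (2.150) p.249, dictionary] -/
def dPdP (μ ν : Fin (d + 1)) (x x' : ↥(i.XB)) : ℝ := (((nK i : ℕ) : ℝ)) ^ (2 + (d + 1)) * dPd i μ ν x x'

/-- the outer kernels in print's units: `η·K` (`∂^η G′_η = η·∂G′`). [cite: Balaban1984PropagatorsII, (2.88) p.238, dictionary] -/
def K1P (μ : Fin (d + 1)) (x : ↥(i.XB)) : ↥(bset i.D) → ↥(bset i.D) → ℝ :=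
  fun y y₁ => (((nK i : ℕ) : ℝ))⁻¹ * K1 i μ x y y₁

/-- … and `η·K₃`. [cite: Balaban1984PropagatorsII, (2.88) p.238, dictionary] -/
def K3P (ν : Fin (d + 1)) (x' : ↥(i.XB)) : ↥(bset i.D) → ↥(bset i.D) → ℝ :=
  fun y₂ y' => (((nK i : ℕ) : ℝ))⁻¹ * K3 i ν x' y₂ y'

/-- **THE FACTORISATION IN PRINT'S UNITS**: `(∂P∂*)_{μν}(x, x′) = Σ_{y₁,y₂} (ηK₁)(y, y₁)·Cinv(y₁, y₂)·(ηK₃)(y₂, y′)` with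
`Cinv` = `B6Prop23KLevelCensus.CinvP`. [cite: Balaban1984PropagatorsII, (2.88) p.238] -/
theorem dPdP_eq_comp3 (μ ν : Fin (d + 1)) (x x' : ↥(i.XB)) :
    dPdP i μ ν x x' = comp3 (K1P i μ x) (CinvP i).ker (K3P i ν x') (blkOf i.D x) (blkOf i.D x') := by
  have hη := nK_pos i
  unfold dPdP
  rw [dPd_eq_comp3]
  unfold comp3 K1P K3P Cker
  simp_rw [CinvP_ker]
  rw [Finset.mul_sum]
  refine Finset.sum_congr rfl fun y₁ _ => ?_
  rw [Finset.mul_sum]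
  refine Finset.sum_congr rfl fun y₂ _ => ?_
  have hn0 : (((nK i : ℕ) : ℝ)) ≠ 0 := hη.ne'
  field_simp
  ring

end Kernel

/-! ## §3 The reading discharged: `λ = Q′*δ_{y₁}` and the domination by entry (2.67)₂ -/

section Reading

variable {ℓ : ℕ} (i : KIdx d ℓ)

/-- `supp λ_{y₁} ⊂ B(y₁)` in the census sense. [cite: Balaban1984PropagatorsII, Prop. 2.2 p.234 («supp λ ⊂ B^{j′}(y′)»)] -/
theorem lam_suppIn (y₁ : ↥(bset i.D)) : (geoB i).suppIn (lam i y₁) y₁ := by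
  intro x hx
  by_contra h
  exact hx (by unfold lam; rw [if_neg h])

/-- `|λ_{y₁}| ≤ 1` (`c_Q = 1`). [cite: Balaban1984PropagatorsII, (2.3)–(2.4) p.224, bookkeeping] -/
theorem supNorm_lam_le (y₁ : ↥(bset i.D)) : (geoB i).supNorm (lam i y₁) ≤ 1 := by
  show i.supF (lam i y₁) ≤ 1
  unfold KIdx.supF
  refine ciSup_le fun x => ?_
  unfold lam; split_ifs <;> simp

/-- entry (2.67)₂ of the member is non-negative. [cite: Balaban1984PropagatorsII, Prop. 2.2 (2.67) p.234, bookkeeping] -/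
theorem e1_nonneg (f : ↥(i.XB) → ℝ) (s : ↥(bset i.D)) : 0 ≤ i.e1 f s := by
  unfold KIdx.e1
  refine le_ciSup_of_le (Set.finite_range _).bddAbove ⟨i.origin, 0⟩ ?_
  split_ifs
  · exact abs_nonneg _
  · exact le_rfl

/-- the lattice outer kernel is dominated by entry (2.67)₂: `|K₁(y, y₁)| ≤ e₁(λ_{y₁}, y)`. [cite: Balaban1984PropagatorsII, (2.88) p.238 («from … Proposition 2.2»)] -/
theorem abs_K1_le (μ : Fin (d + 1)) (x : ↥(i.XB)) (y y₁ : ↥(bset i.D)) : |K1 i μ x y y₁| ≤ i.e1 (lam i y₁) y := by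
  unfold K1
  by_cases h : blkOf i.D x = y
  · rw [if_pos h, KIdx.dMat_G_mulVec]
    unfold KIdx.e1
    refine le_ciSup_of_le (Set.finite_range _).bddAbove ⟨x, μ⟩ ?_
    dsimp only
    rw [if_pos h]
  · rw [if_neg h, abs_zero]; exact e1_nonneg i _ _

/-- the same for `K₃`. [cite: Balaban1984PropagatorsII, (2.88) p.238] -/
theorem abs_K3_le (ν : Fin (d + 1)) (x' : ↥(i.XB)) (y₂ y' : ↥(bset i.D)) : |K3 i ν x' y₂ y'| ≤ i.e1 (lam i y₂) y' := by
  unfold K3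
  by_cases h : blkOf i.D x' = y'
  · rw [if_pos h, KIdx.dMat_G_mulVec]
    unfold KIdx.e1
    refine le_ciSup_of_le (Set.finite_range _).bddAbove ⟨x', ν⟩ ?_
    dsimp only
    rw [if_pos h]
  · rw [if_neg h, abs_zero]; exact e1_nonneg i _ _

/-- **THE READING IN PRINT'S UNITS**: `|η·K₁(y, y₁)| ≤ (gpP i).e 1 (λ_{y₁}) y` (entry `∇G′` of the genuine functionals, which
carries the factor `η` of `∇^η`). [cite: Balaban1984PropagatorsII, (2.88) p.238, Prop. 2.2 (2.67) p.234] -/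
theorem abs_K1P_le (μ : Fin (d + 1)) (x : ↥(i.XB)) (y y₁ : ↥(bset i.D)) :
    |K1P i μ x y y₁| ≤ (gpB i).e 1 (lam i y₁) y := by
  have hη := nK_pos i
  show |(((nK i : ℕ) : ℝ))⁻¹ * K1 i μ x y y₁| ≤ ((((nK i : ℕ) : ℝ))⁻¹) ^ (B6Prop22KLevelCensusEta.epow 1) * i.gp.e 1 (lam i y₁) y
  have he : i.gp.e 1 = i.e1 := rfl
  rw [he, show B6Prop22KLevelCensusEta.epow 1 = 1 from rfl, pow_one, abs_mul, abs_of_pos (inv_pos.2 hη)]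
  exact mul_le_mul_of_nonneg_left (abs_K1_le i μ x y y₁) (inv_nonneg.2 hη.le)

/-- … and for `K₃`. [cite: Balaban1984PropagatorsII, (2.88) p.238, Prop. 2.2 (2.67) p.234] -/
theorem abs_K3P_le (ν : Fin (d + 1)) (x' : ↥(i.XB)) (y₂ y' : ↥(bset i.D)) :
    |K3P i ν x' y₂ y'| ≤ (gpB i).e 1 (lam i y₂) y' := by
  have hη := nK_pos i
  show |(((nK i : ℕ) : ℝ))⁻¹ * K3 i ν x' y₂ y'| ≤ ((((nK i : ℕ) : ℝ))⁻¹) ^ (B6Prop22KLevelCensusEta.epow 1) * i.gp.e 1 (lam i y₂) y'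
  have he : i.gp.e 1 = i.e1 := rfl
  rw [he, show B6Prop22KLevelCensusEta.epow 1 = 1 from rfl, pow_one, abs_mul, abs_of_pos (inv_pos.2 hη)]
  exact mul_le_mul_of_nonneg_left (abs_K3_le i ν x' y₂ y') (inv_nonneg.2 hη.le)

end Reading

/-! ## §4 (2.88) for the genuine `k`-level kernel -/

/-- `t^m ≤ e^{E}` once `m·log t ≤ E` (`t > 0`), for the largeness conditions `L⁴, L^{d+1}, L ≤ e^{αδRM}`. [cite: Balaban1984PropagatorsII, (2.59) p.233, bookkeeping] -/
private theorem rpow_le_exp_of_mul_log_le {t m E : ℝ} (ht : 0 < t) (h : m * Real.log t ≤ E) : t ^ m ≤ Real.exp E := by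
  rw [Real.rpow_def_of_pos ht]
  exact Real.exp_le_exp.2 (by rw [mul_comm]; exact h)

/-- **[B6] (2.88), FIRST INEQUALITY, FOR THE GENUINE `k`-LEVEL KERNEL — the census decl `B6Cor28.Ineq288` INHABITED**:
`∃ M₃ δ₂ C > 0 ∀ i, M₃ ≤ L·M_h → ∀ μ ν x x′, Ineq288 (geoB i) (d+1) (ηK₁) Cinv (ηK₃) C δ₂` for the genuine outer kernels and
the genuine `(Q′G′²Q′*)⁻¹` — `B6Ineq288Edge.ineq288_of_printed` BY NAME on `geoB` fed with the transferred census facts, the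
reading of §3, (2.54), (2.60)/(2.61) of the box and the three largeness conditions (`α = ½`, `δ = min(δ₀, δ₁)/4`).
[cite: Balaban1984PropagatorsII, (2.88) p.238; Lemma 2.1 p.234; Prop. 2.2 p.234; Prop. 2.3 p.238] -/
theorem ineq288_read_kLevelP (d ℓ : ℕ) (hℓ : 1 ≤ ℓ) :
    ∃ M₃ δ₂ C : ℝ, 0 < M₃ ∧ 0 < δ₂ ∧ 0 < C ∧
      ∀ i : KIdx d ℓ, M₃ ≤ ((ℓ : ℝ) + 1) * i.Mh → ∀ (μ ν : Fin (d + 1)) (x x' : ↥(i.XB)),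
        Ineq288 (geoB i) (d + 1) (K1P i μ x) (CinvP i).ker (K3P i ν x') C δ₂ := by
  obtain ⟨M₂, δ₀, δ₁, C', C'', hM₂, hδ₀, hδ₁, hC', hC'', hall⟩ :=
    ineq288_of_printed (d + 1) (fun i : KIdx d ℓ => geoB i) (fun i => gpB i) (fun i => CinvB i)
      (prop22Printed_kLevelB (d := d) hℓ) (prop23Printed_kLevelB (d := d) hℓ)
  have hL0 : (0 : ℝ) < (ℓ : ℝ) + 1 := by positivity
  have hL1 : (1 : ℝ) ≤ (ℓ : ℝ) + 1 := by linarith [(Nat.cast_nonneg ℓ : (0 : ℝ) ≤ ℓ)]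
  have hlog : Real.log ((ℓ : ℝ) + 1) ≤ (ℓ : ℝ) + 1 := (Real.log_le_sub_one_of_pos hL0).trans (by linarith)
  have hlog0 : 0 ≤ Real.log ((ℓ : ℝ) + 1) := Real.log_nonneg hL1
  -- the rate of Lemma 2.1: `δ = min(δ₀, δ₁)/4`, `α = ½`
  obtain ⟨δ, hδ⟩ : ∃ δ : ℝ, δ = min δ₀ δ₁ / 4 := ⟨_, rfl⟩
  have hδpos : 0 < δ := by rw [hδ]; exact div_pos (lt_min hδ₀ hδ₁) (by norm_num)
  have hδa : δ + 2 * (1 / 2 * δ) ≤ δ₀ / 2 := by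
    have : min δ₀ δ₁ ≤ δ₀ := min_le_left _ _
    rw [hδ]; linarith
  have hδb : δ + 1 / 2 * δ ≤ δ₁ / 2 := by
    have : min δ₀ δ₁ ≤ δ₁ := min_le_right _ _
    rw [hδ]; linarith
  -- the (2.59)-type threshold for (2.61) at `(δ, ½)` and the largeness thresholds
  obtain ⟨N₁, hN₁⟩ : ∃ N₁ : ℕ, N₁ = ⌈8 * ((d : ℝ) + 1) * ((ℓ : ℝ) + 1) / δ⌉₊ + 1 := ⟨_, rfl⟩
  have hN₁pos : 0 < N₁ := by rw [hN₁]; omega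
  have hN₁ge : 8 * ((d : ℝ) + 1) * ((ℓ : ℝ) + 1) < δ * (N₁ : ℝ) := by
    have h : 8 * ((d : ℝ) + 1) * ((ℓ : ℝ) + 1) / δ < (N₁ : ℝ) := by
      rw [hN₁]; push_cast; exact lt_of_le_of_lt (Nat.le_ceil _) (by linarith)
    rw [div_lt_iff₀ hδpos] at h; linarith
  have hθ1 : Real.exp (-(1 / 2 * δ)) * ((ℓ : ℝ) + 1) ^ ((2 * (d + 1 : ℕ) : ℝ) / N₁) < 1 := by
    refine theta_lt_one_of_log hL0 hN₁pos ?_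
    push_cast
    have hd0 : (0 : ℝ) ≤ 2 * ((d : ℝ) + 1) := by positivity
    have h1 := mul_le_mul_of_nonneg_left hlog hd0
    have h2 : (0 : ℝ) ≤ ((d : ℝ) + 1) * ((ℓ : ℝ) + 1) := by positivity
    linarith
  obtain ⟨N₂, hN₂⟩ : ∃ N₂ : ℕ, N₂ = ⌈2 * ((d : ℝ) + 5) * ((ℓ : ℝ) + 1) / δ⌉₊ := ⟨_, rfl⟩
  have hN₂ge : 2 * ((d : ℝ) + 5) * ((ℓ : ℝ) + 1) ≤ δ * (N₂ : ℝ) := by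
    have h : 2 * ((d : ℝ) + 5) * ((ℓ : ℝ) + 1) / δ ≤ (N₂ : ℝ) := by rw [hN₂]; exact Nat.le_ceil _
    rw [div_le_iff₀ hδpos] at h; linarith
  obtain ⟨cL, hcL⟩ : ∃ cL : ℝ, cL = K261 N₁ (d + 1) ((ℓ : ℝ) + 1) 1 (1 / 2 * δ) := ⟨_, rfl⟩
  have hcL0 : 0 ≤ cL := by rw [hcL]; exact K261_nonneg (by positivity) zero_le_one
  obtain ⟨M₃, hM₃⟩ : ∃ M₃ : ℝ, M₃ = max M₂ (max ((N₁ : ℝ) + 1) ((N₂ : ℝ) + 1)) := ⟨_, rfl⟩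
  have hM₃pos : 0 < M₃ := by rw [hM₃]; exact lt_max_of_lt_left hM₂
  obtain ⟨C, hC⟩ : ∃ C : ℝ, C = C' * 1 * C'' * (C' * 1) * ((ℓ : ℝ) + 1) ^ (4 : ℝ) *
      ((ℓ : ℝ) + 1) ^ ((d + 1 : ℕ) : ℝ) * ((ℓ : ℝ) + 1) ^ (1 : ℝ) * cL ^ 3 + 1 := ⟨_, rfl⟩
  have hCbase : 0 ≤ C' * 1 * C'' * (C' * 1) * ((ℓ : ℝ) + 1) ^ (4 : ℝ) *
      ((ℓ : ℝ) + 1) ^ ((d + 1 : ℕ) : ℝ) * ((ℓ : ℝ) + 1) ^ (1 : ℝ) * cL ^ 3 := by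
    have := Real.rpow_nonneg hL0.le (4 : ℝ)
    have := Real.rpow_nonneg hL0.le ((d + 1 : ℕ) : ℝ)
    have := Real.rpow_nonneg hL0.le (1 : ℝ)
    have := hC'.le; have := hC''.le
    positivity
  have hCpos : 0 < C := by rw [hC]; linarith
  refine ⟨M₃, (1 - 1 / 2) * δ, C, hM₃pos, by positivity, hCpos, ?_⟩
  intro i hM μ ν x x'
  -- the member's thresholds
  have hM2 : M₂ ≤ (geoB i).M := by rw [geoB_M]; exact (le_max_left _ _).trans (hM₃ ▸ hM)
  have hR1 : 1 ≤ i.R := le_trans (by omega) i.hR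
  have hNle : ∀ N : ℕ, (N : ℝ) + 1 ≤ ((ℓ : ℝ) + 1) * i.Mh → N + 1 ≤ i.R * ((ℓ + 1) * i.Mh) := by
    intro N hN
    have h1 : ((N + 1 : ℕ) : ℝ) ≤ (((ℓ + 1) * i.Mh : ℕ) : ℝ) := by push_cast; exact hN
    have h2 : N + 1 ≤ (ℓ + 1) * i.Mh := by exact_mod_cast h1
    exact h2.trans (Nat.le_mul_of_pos_left _ hR1)
  have hRM1 : N₁ + 1 ≤ i.R * ((ℓ + 1) * i.Mh) :=
    hNle N₁ (((le_max_left _ _).trans (le_max_right _ _)).trans (hM₃ ▸ hM))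
  have hRM2 : N₂ + 1 ≤ i.R * ((ℓ + 1) * i.Mh) :=
    hNle N₂ (((le_max_right _ _).trans (le_max_right _ _)).trans (hM₃ ▸ hM))
  -- Lemma 2.1 on the box at `(δ, ½)`
  obtain ⟨-, h261, -, -⟩ :=
    lemma21_box i.D i.hMh i.hP hN₁pos hRM1 hδpos.le (α := 1 / 2) (by norm_num) (by norm_num) hθ1
  have h261B : Ineq261With cL (geoB i) δ (1 / 2) := by rw [hcL]; exact fun z => h261 z
  have h260B : Ineq260 (geoB i) δ (1 / 2) := ineq260_geoB i (by positivity)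
  -- the three largeness conditions `L⁴, L^{d+1}, L ≤ e^{½δ·RM}`, `RM = R·L·M_h − 1 ≥ N₂`
  have hge : (N₂ : ℝ) ≤ (i.R : ℝ) * (((ℓ : ℝ) + 1) * i.Mh) - 1 := by
    have : ((N₂ + 1 : ℕ) : ℝ) ≤ ((i.R * ((ℓ + 1) * i.Mh) : ℕ) : ℝ) := by exact_mod_cast hRM2
    push_cast at this; linarith
  have hE : ((d : ℝ) + 5) * Real.log ((ℓ : ℝ) + 1) ≤ 1 / 2 * δ * (geoB i).R * (geoB i).M := by
    rw [mul_assoc (1 / 2 * δ), geoB_RM]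
    have h3 := mul_le_mul_of_nonneg_left hge (by positivity : (0 : ℝ) ≤ 1 / 2 * δ)
    have hd5 : (0 : ℝ) ≤ (d : ℝ) + 5 := by positivity
    have h4 := mul_le_mul_of_nonneg_left hlog hd5
    linarith
  have hl4 : (geoB i).L ^ (4 : ℝ) ≤ Real.exp (1 / 2 * δ * (geoB i).R * (geoB i).M) := by
    rw [geoB_L]; refine rpow_le_exp_of_mul_log_le hL0 (le_trans ?_ hE); nlinarith
  have hld : (geoB i).L ^ ((d + 1 : ℕ) : ℝ) ≤ Real.exp (1 / 2 * δ * (geoB i).R * (geoB i).M) := by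
    rw [geoB_L]; refine rpow_le_exp_of_mul_log_le hL0 (le_trans ?_ hE); push_cast; nlinarith
  have hl1 : (geoB i).L ^ (1 : ℝ) ≤ Real.exp (1 / 2 * δ * (geoB i).R * (geoB i).M) := by
    rw [geoB_L]; refine rpow_le_exp_of_mul_log_le hL0 (le_trans ?_ hE); nlinarith
  -- the edge, fired
  have h := hall i trivial hM2 (triangle_geoB i) (dist_nonneg_geoB i) (dist_symm_geoB i) (by rw [geoB_L]; exact hL1)
    (by rw [geoB_eta]; exact inv_pos.2 (nK_pos i)) 1 1 (fun t => rfl) (fun t => rfl) (K1P i μ x) (K3P i ν x')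
    (lam i) (lam i) 1 zero_le_one (lam_suppIn i) (supNorm_lam_le i) (lam_suppIn i) (supNorm_lam_le i)
    (abs_K1P_le i μ x) (abs_K3P_le i ν x') δ (1 / 2) cL hδpos.le (by norm_num) (by norm_num) hδa hδb h260B h261B
    hl4 hld hl1
  -- monotonicity in the constant
  intro y y'
  refine (h y y').trans ?_
  rw [geoB_L]
  have hrest : 0 ≤ (geoB i).len y ^ (-(2 : ℝ)) * (geoB i).len y' ^ (-((d + 1 : ℕ) : ℝ)) *
      Real.exp (-((1 - 1 / 2) * δ * (geoB i).dist y y')) := by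
    have hl : ∀ s, 0 < (geoB i).len s := fun s => by
      rw [geoB_len]; exact mul_pos (pow_pos hL0 _) (inv_pos.2 (nK_pos i))
    have := Real.rpow_nonneg (hl y).le (-(2 : ℝ))
    have := Real.rpow_nonneg (hl y').le (-((d + 1 : ℕ) : ℝ))
    positivity
  have hCle : C' * 1 * C'' * (C' * 1) * ((ℓ : ℝ) + 1) ^ (4 : ℝ) * ((ℓ : ℝ) + 1) ^ ((d + 1 : ℕ) : ℝ) *
      ((ℓ : ℝ) + 1) ^ (1 : ℝ) * cL ^ 3 ≤ C := by rw [hC]; linarith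
  calc C' * 1 * C'' * (C' * 1) * ((ℓ : ℝ) + 1) ^ (4 : ℝ) * ((ℓ : ℝ) + 1) ^ ((d + 1 : ℕ) : ℝ) *
        ((ℓ : ℝ) + 1) ^ (1 : ℝ) * cL ^ 3 * (geoB i).len y ^ (-(2 : ℝ)) * (geoB i).len y' ^ (-((d + 1 : ℕ) : ℝ)) *
        Real.exp (-((1 - 1 / 2) * δ * (geoB i).dist y y'))
      = C' * 1 * C'' * (C' * 1) * ((ℓ : ℝ) + 1) ^ (4 : ℝ) * ((ℓ : ℝ) + 1) ^ ((d + 1 : ℕ) : ℝ) *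
        ((ℓ : ℝ) + 1) ^ (1 : ℝ) * cL ^ 3 * ((geoB i).len y ^ (-(2 : ℝ)) * (geoB i).len y' ^ (-((d + 1 : ℕ) : ℝ)) *
        Real.exp (-((1 - 1 / 2) * δ * (geoB i).dist y y'))) := by ring
    _ ≤ C * ((geoB i).len y ^ (-(2 : ℝ)) * (geoB i).len y' ^ (-((d + 1 : ℕ) : ℝ)) *
        Real.exp (-((1 - 1 / 2) * δ * (geoB i).dist y y'))) := mul_le_mul_of_nonneg_right hCle hrest
    _ = _ := by ring

/-- **[B6] THE PRINTED (2.88) FOR THE GENUINE `k`-LEVEL KERNEL `(∂P∂*)_{μν}(x, x′)`** in print's units: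
`|(∂P∂*)_{μν}(x, x′)| ≤ C·(L^jη)^{−2}(L^{j′}η)^{−(d+1)}e^{−δ₂d(y,y′)}`, `x ∈ B^j(y)`, `x′ ∈ B^{j′}(y′)`, all `μ, ν`, for every
member with `L·M_h ≥ M₃` (every `k`, every nested family, every box) — the census edge with every hypothesis discharged and the
exact factorisation `dPdP_eq_comp3`. [cite: Balaban1984PropagatorsII, (2.88) p.238] -/
theorem ineq288_kLevelP (d ℓ : ℕ) (hℓ : 1 ≤ ℓ) :
    ∃ M₃ δ₂ C : ℝ, 0 < M₃ ∧ 0 < δ₂ ∧ 0 < C ∧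
      ∀ i : KIdx d ℓ, M₃ ≤ ((ℓ : ℝ) + 1) * i.Mh → ∀ (μ ν : Fin (d + 1)) (x x' : ↥(i.XB)),
        |dPdP i μ ν x x'| ≤ C * (geoP i).len (blkOf i.D x) ^ (-(2 : ℝ)) *
          (geoP i).len (blkOf i.D x') ^ (-((d + 1 : ℕ) : ℝ)) *
          Real.exp (-(δ₂ * (geom i.D).dist (blkOf i.D x) (blkOf i.D x'))) := by
  obtain ⟨M₃, δ₂, C, hM₃, hδ₂, hC, h⟩ := ineq288_read_kLevelP d ℓ hℓ
  refine ⟨M₃, δ₂, C, hM₃, hδ₂, hC, fun i hM μ ν x x' => ?_⟩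
  have hI := h i hM μ ν x x' (blkOf i.D x) (blkOf i.D x')
  have hE := dPdP_eq_comp3 i μ ν x x'
  calc |dPdP i μ ν x x'| = |comp3 (K1P i μ x) (CinvP i).ker (K3P i ν x') (blkOf i.D x) (blkOf i.D x')| := by
        rw [hE]
    _ ≤ _ := hI

/-- **NON-VACUITY**: above every threshold there are members with `k ≥ 2` genuine levels (gen 12's `kLevelP_nonvacuous`).
[cite: Balaban1984PropagatorsII, (2.1)–(2.4) p.224, bookkeeping] -/
theorem ineq288_kLevelP_nonvacuous (d ℓ k : ℕ) (hk : 2 ≤ k) (M₃ : ℝ) :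
    ∃ i : KIdx d ℓ, i.k = k ∧ M₃ ≤ ((ℓ : ℝ) + 1) * i.Mh :=
  let ⟨i, h1, h2, _, _, _⟩ := kLevelP_nonvacuous d ℓ k hk M₃
  ⟨i, h1, h2⟩

end

end Literature.MathematicalPhysics.QuantumFieldTheory.Balaban1983to89.B6Ineq288MultiLevelBox
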